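import Summits.ResolutionOfSingularities.ResolutionOfSingularities.Theorems.HilbertSamuelEliminationSigmaMaxModificationsCorridor3SigmaIsoBoundaryExtraction
import Summits.ResolutionOfSingularities.ResolutionOfSingularities.Theorems.HilbertSamuelEliminationSigmaMaxModificationsCorridor3WLadderIsoStepBirth
import HarnessLib

/-!
# [OURS · L1 W4.2] σ-LAYER — `Corridor3SigmaIsoBoundaryTransition`: THE ISO → NON-ISO TRANSITION LAW HOLDS FOR EVERY ADMISSIBLE BOUNDARY-READING STRATEGY
# (`IsoTransitionLaw3σE σ p Q E₀`), and the POINTED σE-CLOSER FROM ADMISSIBILITY + KERNEL + σ-BIRTH LAW ONLY (res-L1-w42-plan-1 RULING v3.14-12a (BR-10),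
# E-threaded; W4.2 DEAL D16-σ, RULINGS v3.14-11a (CP); crux chain w42 `SigmaMaxModificationsCorridor3` stmt-ResolutionOfSingularities-19249 / crux stmt-…-18506;
# `--supports stmt-ResolutionOfSingularities-19249 --as helper`, counted 0)

HONEST FRAMING. OURS proof file (theorem-only, no new definition, fact-free); NOTHING here is a statement of H. Hironaka's manuscript [Hironaka2017] nor of
Cossart–Jannsen–Saito. Every `theorem` is the E-COPY of the BLIND theorem of the same name without `E` in `…Corridor3SigmaIsoTransition` (p527494) — itself the
σ-port of res-L1-type-o1's D17 (i) transition lemma and `isoTransitionLaw3_holds` (p520356) with the maximal-origin kit replacing the CJS cycle invariant — plus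
the `StepProjectionσE` API (E-copies of res-type-040's `…Corridor3SigmaStrataLineages` §1). No functionality of σ is needed for the law. CONSEQUENCE: for a
functional boundary-reading σ admissible on the E-threaded marked scope, the pointed σE-closer needs only the strategy-free KERNEL `IsoQuadraticTowerTerminates p 3`
and the conjecture-tagged σ-birth law `NoRecurrentIsoPointBirth3σE σ p QPointed E₀` — this is the form the hybrid `ω_ρ` (a `StrategyE`) consumes at its
pointed stages. AI-written; AI review is weaker than expert review.

## Contents (namespace `…Theorems.SigmaMaxModificationsCorridor3.Sigma`)

* §1 `StepProjectionσE` API: `CanonicalNearStepσE.exists_stepProjectionσE`, `StepProjectionσE.canonicalNearStepσE/base_pt/pt_mem_hsStratum/unique`.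
* §2 `StepProjectionσE.image_hsStratum_subset`. §3 `closure_image_eq_singleton_of_isoσE`, `exists_isoStepBirth_of_iso_of_not_isoσE`.
* §4 **`isoTransitionLaw3σE_of_admissible (hadm : ∀ ν, IsAdmissibleStrategyOnE (StrategyE.ReachableState p σ 3 ν E₀) 3 ν σ) (Q) : IsoTransitionLaw3σE σ p Q E₀`**,
  `wtopAltMσE_of_admissible_of_birthLaw`, **`wtopRecIsoMσE_pointed_of_admissible_of_birthLaw (hfun) (hadm) (hT : IsoQuadraticTowerTerminates p 3)
  (hrec : NoRecurrentIsoPointBirth3σE σ p QPointed E₀) : WtopRecIsoMσE σ p QPointed E₀`**, `wtopRecIsoMσE_of_admissible_of_birthLaw` (every `Q`),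
  `atQσE_of_admissible_of_birthLaw_evNonIso` (the FULL W-top σE-row at `Q` from admissibility + KERNEL + σ-birth law + o1's `WtopEvNonIsoMσE σ p Q E₀`).

## References (context only)

* V. Cossart, U. Jannsen, S. Saito, LNM 2270 (2020): Thm. 3.10 (1), Rem. 6.29 (1), Def. 13.3, Lemma 2.36. [CossartJannsenSaito2020]
-/

noncomputable section

set_option linter.dupNamespace false -- mandated namespace of this single-conjunct summit

open CategoryTheory AlgebraicGeometry TopologicalSpace Topology
open Literature.AlgebraicGeometry.Resolution Literature.RingTheory.HilbertSamuel
open Literature.AlgebraicGeometry.CossartJannsenSaito2020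
open Summit.ResolutionOfSingularities.ResolutionOfSingularities.Theorems.CampaignW42
open Summit.ResolutionOfSingularities.ResolutionOfSingularities.Theorems.SigmaMaxModificationsCorridor3.Moving
open Summit.ResolutionOfSingularities.ResolutionOfSingularities.Theorems.SigmaMaxModificationsCorridor3.Helpers (QPointed)
open Summit.ResolutionOfSingularities.ResolutionOfSingularities.Cruxes.SigmaMaxModifications.IdeasL1Idea2R4

namespace Summit.ResolutionOfSingularities.ResolutionOfSingularities.Theorems.SigmaMaxModificationsCorridor3.Sigma

universe u

variable {p : ℕ} {σ : StrategyE.{u}} {N : ℕ} {ν : ℕ → ℕ} {E₀ : ∀ (X : Scheme.{u}), X → Boundary X}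

/-! ## §1. Step projections of boundary-threaded σ-near steps -/

/-- Every boundary-threaded σ-near step has a step projection. [folklore] -/
theorem CanonicalNearStepσE.exists_stepProjectionσE {s s' : MarkedStageE.{u}} (h : CanonicalNearStepσE σ N ν s s') :
    ∃ f : s'.W ⟶ s.W, StepProjectionσE σ N ν s s' f := by
  obtain ⟨C, P', hln, x', hcs, hπ, hcl, hx', rfl⟩ := h
  exact ⟨blowup.π C, C, P', hln, x', hcs, hπ, hcl, hx', rfl, by simp⟩

namespace StepProjectionσE

variable {s s' : MarkedStageE.{u}} {f g : s'.W ⟶ s.W}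

/-- A σE-step projection presents a boundary-threaded σ-near step. [folklore] -/
theorem canonicalNearStepσE (hf : StepProjectionσE σ N ν s s' f) : CanonicalNearStepσE σ N ν s s' := by
  obtain ⟨C, P', hln, x', hcs, hπ, hcl, hx', e, -⟩ := hf
  exact ⟨C, P', hln, x', hcs, hπ, hcl, hx', e⟩

/-- The σE-step projection maps the marked point to the marked point (`x_{n+1} ↦ x_n`). [folklore] -/
theorem base_pt (hf : StepProjectionσE σ N ν s s' f) : f.base s'.pt = s.pt := by
  obtain ⟨C, P', hln, x', -, hπ, -, -, e, rfl⟩ := hf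
  subst e
  simpa using hπ

/-- The marked point of the target lies in the `ν`-stratum. [folklore] -/
theorem pt_mem_hsStratum (hf : StepProjectionσE σ N ν s s' f) : s'.pt ∈ Scheme.hsStratum s'.W N ν :=
  hf.canonicalNearStepσE.pt_mem_hsStratum

/-- For a FUNCTIONAL σ the σE-step projection is unique. [folklore] -/
theorem unique (hfun : σ.IsFunctional N ν) (hf : StepProjectionσE σ N ν s s' f) (hg : StepProjectionσE σ N ν s s' g) : f = g := by
  obtain ⟨C₁, P₁, h₁, x₁, hcs₁, -, -, -, e₁, rfl⟩ := hf
  obtain ⟨C₂, P₂, h₂, x₂, hcs₂, -, -, -, e₂, rfl⟩ := hg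
  obtain rfl : C₁ = C₂ := (hfun s.W s.ln s.L s.P s.E).1 C₁ C₂ P₁ P₂ hcs₁ hcs₂
  rfl

end StepProjectionσE


/-! ## §2. The blow-down of an admissible σ-step maps the stratum into the stratum -/

/-- **The blow-down of an ADMISSIBLE σ-step from a σ-reached stage maps `X_{n+1}(ν)` into `X_n(ν)`**: the centre is permissible
(admissibility (a)(i)), so `H^N` does not increase along the blow-up of the excellent reached stage (CJS Thm. 3.10 (1), tree-proved
`IsBlowup.hsFun_le_of_isPermissible`), and `ν` is never exceeded on the reached stage (it is a maximal origin, `IsMaximalOrigin.of_reachesσE`).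
σ-port of stub-4's `StepProjection.image_hsStratum_subset`. [cite: CossartJannsenSaito2020, Thm. 3.10 (1)] -/
theorem StepProjectionσE.image_hsStratum_subset (hadm : IsAdmissibleStrategyOnE (StrategyE.ReachableState p σ N ν E₀) N ν σ)
    {X : Scheme.{u}} [IsLocallyNoetherian X] {x : X} (hX : IsMaximalOrigin p N ν X x) {s s' : MarkedStageE.{u}}
    (hreach : ReachesσE σ N ν (MarkedStageE.init X x (E₀ X x)) s) {f : s'.W ⟶ s.W} (hf : StepProjectionσE σ N ν s s' f) :
    f.base '' Scheme.hsStratum s'.W N ν ⊆ Scheme.hsStratum s.W N ν := by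
  obtain ⟨C, P', hln, x', hcs, -, -, -, e, rfl⟩ := hf
  subst e
  haveI : IsLocallyNoetherian s.W := s.ln
  have hO : IsMaximalOrigin p N ν s.W s.pt := hX.of_reachesσE hadm hreach
  have hperm : IdealSheafData.IsPermissible C := (hadm.step_specE (inScopeMσE_of_reachesσE hX hreach) hcs).1
  obtain ⟨k, _, _, g, -, hft, -⟩ := hO.exists_structure
  haveI := hft
  have hexc : Scheme.IsExcellent s.W := Scheme.isExcellent_of_locallyOfFiniteType Stacks07QW_field_holds g
  have hsup : ∀ w : s.W, ν ≤ Scheme.hsFun s.W N w → Scheme.hsFun s.W N w = ν :=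
    fun w hw => le_antisymm (hO.maximal.2 ⟨w, rfl⟩ hw) hw
  rintro _ ⟨z, hz, rfl⟩
  simp only [eqToHom_refl, Category.id_comp]
  exact hsup _ ((Scheme.mem_hsStratum_iff.mp hz).symm.le.trans ((blowup.isBlowup C).hsFun_le_of_isPermissible hexc hperm N z))

/-! ## §3. D17 (i) for σ-steps: at an isolated marked point every component through the next marked point collapses to it -/

/-- **Every component of `X_{n+1}(ν)` through `x_{n+1}` collapses to the ISOLATED `x_n`** — along a σ-step projection from a σ-reached stage
(σ admissible on the marked scope): `closure (f '' Z') = {x_n}`. σ-port of res-L1-type-o1's `Moving.closure_image_eq_singleton_of_iso`, same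
proof with the maximal-origin kit in place of the cycle invariant. [cite: CossartJannsenSaito2020, Thm. 3.10 (1), Def. 13.3] -/
theorem closure_image_eq_singleton_of_isoσE (hadm : IsAdmissibleStrategyOnE (StrategyE.ReachableState p σ N ν E₀) N ν σ)
    {X : Scheme.{u}} [IsLocallyNoetherian X] {x : X} (hX : IsMaximalOrigin p N ν X x) {s s' : MarkedStageE.{u}}
    (hreach : ReachesσE σ N ν (MarkedStageE.init X x (E₀ X x)) s) {f : s'.W ⟶ s.W} (hf : StepProjectionσE σ N ν s s' f) (hiso : Iso N s.toMarkedStage)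
    {Z' : Set s'.W} (hZ' : Z' ∈ componentsThrough N ν s'.toMarkedStage) : closure (f.base '' Z') = {s.pt} := by
  haveI : IsLocallyNoetherian s.W := s.ln
  have hO : IsMaximalOrigin p N ν s.W s.pt := hX.of_reachesσE hadm hreach
  have hcl : IsClosed ({s.pt} : Set s.W) := hO.isClosed
  obtain ⟨U, hU, hptU, hUν⟩ := hO.exists_isOpen_inter_hsStratum_eq hiso
  -- `f(Z') ⊆ X_n(ν)`
  have himg : f.base '' Z' ⊆ Scheme.hsStratum s.W N ν :=
    (Set.image_mono (componentsIn.subset hZ'.1)).trans (hf.image_hsStratum_subset hadm hX hreach)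
  -- `Z'` meets the open `f⁻¹ U` at `x_{n+1}` and is irreducible, hence lies in the closure of `Z' ∩ f⁻¹ U ⊆ f⁻¹ {x_n}`
  have hOp : IsOpen (f.base ⁻¹' U) := hU.preimage f.continuous
  have hpt' : s'.pt ∈ Z' ∩ f.base ⁻¹' U := ⟨hZ'.2, by simpa [Set.mem_preimage, hf.base_pt] using hptU⟩
  have hdense : Z' ⊆ closure (Z' ∩ f.base ⁻¹' U) :=
    subset_closure_inter_of_isPreirreducible_of_isOpen (componentsIn.isIrreducible hZ'.1).isPreirreducible hOp ⟨_, hpt'⟩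
  have hfib : Z' ∩ f.base ⁻¹' U ⊆ f.base ⁻¹' {s.pt} := by
    rintro z ⟨hzZ, hzU⟩
    have : f.base z ∈ U ∩ Scheme.hsStratum s.W N ν := ⟨hzU, himg ⟨z, hzZ, rfl⟩⟩
    rwa [hUν] at this
  have hZ'fib : Z' ⊆ f.base ⁻¹' {s.pt} :=
    hdense.trans ((closure_mono hfib).trans (hcl.preimage f.continuous).closure_subset)
  have himg' : f.base '' Z' = {s.pt} := by
    refine Set.Subset.antisymm ?_ ?_
    · rintro _ ⟨z, hz, rfl⟩
      exact hZ'fib hz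
    · rintro _ rfl
      exact ⟨s'.pt, hZ'.2, hf.base_pt⟩
  rw [himg', hcl.closure_eq]

/-- **D17 (i) FOR σ-STEPS — THE TRANSITION LEMMA**: along a σ-step projection from a σ-reached stage (σ admissible on the marked scope), if
`x_n` IS isolated in the Hilbert–Samuel locus and `x_{n+1}` is NOT, some irreducible component `Z'` of `X_{n+1}(ν)` through `x_{n+1}` is
non-trivial and collapses to `x_n`. The second point of `Z'` comes from stub-4's `CycleInv.exists_ne_of_mem_componentsThrough` at the R-free
cycle invariant of the INITIAL marked stage of the maximal origin `(X_{n+1}, x_{n+1})`. σ-port of res-L1-type-o1's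
`Moving.exists_isoStepBirth_of_iso_of_not_iso`. [cite: CossartJannsenSaito2020, Thm. 3.10 (1), Rem. 6.29 (1), Def. 13.3] -/
theorem exists_isoStepBirth_of_iso_of_not_isoσE (hadm : IsAdmissibleStrategyOnE (StrategyE.ReachableState p σ N ν E₀) N ν σ)
    {X : Scheme.{u}} [IsLocallyNoetherian X] {x : X} (hX : IsMaximalOrigin p N ν X x) {s s' : MarkedStageE.{u}}
    (hreach : ReachesσE σ N ν (MarkedStageE.init X x (E₀ X x)) s) {f : s'.W ⟶ s.W} (hf : StepProjectionσE σ N ν s s' f) (hiso : Iso N s.toMarkedStage)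
    (hni : ¬ Iso N s'.toMarkedStage) : ∃ Z' ∈ componentsThrough N ν s'.toMarkedStage, closure (f.base '' Z') = {s.pt} ∧ Z'.Nontrivial := by
  haveI : IsLocallyNoetherian s'.W := s'.ln
  have hO' : IsMaximalOrigin p N ν s'.W s'.pt := hX.of_reachesσE hadm (hreach.tail hf.canonicalNearStepσE)
  have hpt' : s'.pt ∈ Scheme.hsStratum s'.W N ν := hf.pt_mem_hsStratum
  obtain ⟨Z', hZ'⟩ := componentsThrough_nonempty (N := N) (ν := ν) hpt'
  -- the R-free cycle invariant of the initial marked stage of the maximal origin `(X_{n+1}, x_{n+1})`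
  obtain ⟨k, _, hinv⟩ := hO'.exists_cycleInv (R := fun _ _ => True)
  obtain ⟨y, hyZ, hy⟩ := hinv.exists_ne_of_mem_componentsThrough (Z := Z') hpt' hni hZ'
  exact ⟨Z', hZ', closure_image_eq_singleton_of_isoσE hadm hX hreach hf hiso hZ', ⟨y, hyZ, s'.pt, hZ'.2, hy⟩⟩

/-! ## §4. The σ-transition law for admissible strategies; the pointed σ-closer from admissibility + KERNEL + σ-birth law -/

/-- **THE ISO → NON-ISO TRANSITION LAW HOLDS FOR EVERY STRATEGY ADMISSIBLE ON THE MARKED SCOPE**, at every origin class `Q`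
(`IsoTransitionLaw3σE σ p Q` of `…Corridor3SigmaIsoDefs`; no functionality needed): along a σ-chain from a maximal origin, at an iso → non-iso
step the blow-down carries an iso point birth through the next marked point. σ-form of res-L1-type-o1's `isoTransitionLaw3_holds` (p520356);
no regular-value case split. [cite: CossartJannsenSaito2020, Thm. 3.10 (1), Rem. 6.29 (1), Def. 13.3] -/
theorem isoTransitionLaw3σE_of_admissible (hadm : ∀ ν, IsAdmissibleStrategyOnE (StrategyE.ReachableState p σ 3 ν E₀) 3 ν σ)
    (Q : ℕ → (ℕ → ℕ) → ∀ X : Scheme.{u}, X → Prop) : IsoTransitionLaw3σE σ p Q E₀ := by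
  intro ν X _ x hX _hQ c h0 hstep _hG n hiso hni
  obtain ⟨f, hf⟩ := (hstep n).exists_stepProjectionσE
  obtain ⟨Z', hZ', hcl, hnt⟩ :=
    exists_isoStepBirth_of_iso_of_not_isoσE (hadm ν) hX (reachesσE_chain h0 hstep n) hf hiso hni
  exact ⟨f, hf, Z', hiso, hZ', hcl, hnt.ne_singleton⟩

/-- **ALT σ FROM ADMISSIBILITY AND THE σ-BIRTH LAW** (the transition law discharged). OURS join. -/
theorem wtopAltMσE_of_admissible_of_birthLaw (Q : ℕ → (ℕ → ℕ) → ∀ X : Scheme.{u}, X → Prop)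
    (hadm : ∀ ν, IsAdmissibleStrategyOnE (StrategyE.ReachableState p σ 3 ν E₀) 3 ν σ) (hrec : NoRecurrentIsoPointBirth3σE σ p Q E₀) :
    WtopAltMσE σ p Q E₀ :=
  wtopAltMσE_of_noRecurrentIsoPointBirth3σE (isoTransitionLaw3σE_of_admissible hadm Q) hrec

/-- **THE POINTED σ-CLOSER FROM ADMISSIBILITY, THE KERNEL AND THE σ-BIRTH LAW ONLY** (σ functional at level `3` and admissible on the marked
scope): `WtopRecIsoMσE σ p QPointed ⟸ IsoQuadraticTowerTerminates p 3 ∧ NoRecurrentIsoPointBirth3σE σ p QPointed` — binder for binder the σ-form of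
p521299's `wtopRecIsoM_pointed_of_kernel_of_birthLaw`: the v8.2 pointed closer TRANSFERS TO ARBITRARY ADMISSIBLE STRATEGIES (RULINGS v3.14-11a
(CP)). OURS join. -/
theorem wtopRecIsoMσE_pointed_of_admissible_of_birthLaw (hfun : ∀ ν, σ.IsFunctional 3 ν)
    (hadm : ∀ ν, IsAdmissibleStrategyOnE (StrategyE.ReachableState p σ 3 ν E₀) 3 ν σ) (hT : IsoQuadraticTowerTerminates.{u} p 3)
    (hrec : NoRecurrentIsoPointBirth3σE σ p QPointed E₀) : WtopRecIsoMσE σ p QPointed E₀ :=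
  wtopRecIsoMσE_pointed_of_admissible hfun hadm hT (isoTransitionLaw3σE_of_admissible hadm QPointed) hrec

/-- … at every origin class `Q`. OURS join. -/
theorem wtopRecIsoMσE_of_admissible_of_birthLaw (Q : ℕ → (ℕ → ℕ) → ∀ X : Scheme.{u}, X → Prop) (hfun : ∀ ν, σ.IsFunctional 3 ν)
    (hadm : ∀ ν, IsAdmissibleStrategyOnE (StrategyE.ReachableState p σ 3 ν E₀) 3 ν σ) (hT : IsoQuadraticTowerTerminates.{u} p 3)
    (hrec : NoRecurrentIsoPointBirth3σE σ p Q E₀) : WtopRecIsoMσE σ p Q E₀ :=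
  wtopRecIsoMσE_of_admissible Q hfun hadm hT (isoTransitionLaw3σE_of_admissible hadm Q) hrec

/-- **THE FULL W-top σ-ROW AT `Q` FROM ADMISSIBILITY, THE KERNEL, THE σ-BIRTH LAW AND Ev-NonIso σ** — no moving W-top σ-chain at all from a
`Q`-maximal origin; the σ-DESIGN content left is exactly 047's `WtopEvNonIsoMσE σ p Q` (and the OURS birth law). OURS join. -/
theorem atQσE_of_admissible_of_birthLaw_evNonIso (Q : ℕ → (ℕ → ℕ) → ∀ X : Scheme.{u}, X → Prop) (hfun : ∀ ν, σ.IsFunctional 3 ν)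
    (hadm : ∀ ν, IsAdmissibleStrategyOnE (StrategyE.ReachableState p σ 3 ν E₀) 3 ν σ) (hT : IsoQuadraticTowerTerminates.{u} p 3)
    (hrec : NoRecurrentIsoPointBirth3σE σ p Q E₀) (hev : WtopEvNonIsoMσE σ p Q E₀) :
    MaxOriginNoMovingNearChainAtQσE σ p 3 Q E₀ fun s => 3 ≤ s.geomDirDim :=
  atQσE_of_admissible_evNonIso Q hfun hadm hT (isoTransitionLaw3σE_of_admissible hadm Q) hrec hev

end Summit.ResolutionOfSingularities.ResolutionOfSingularities.Theorems.SigmaMaxModificationsCorridor3.Sigma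

end
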